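import Summits.HodgeConjecture.HodgeConjecture.Theorems.SixfoldTableXCensusRow21CodimTwo
import Literature.AlgebraicGeometry.HodgeTheory.UnitaryTwoOneTimesCMCurveCubeCodimThreeProducts
import HarnessLib

/-!
# TABLE X (dimension 6) — row 21 `g6.E3xY3.(2,1)` (`X ∼ E_k³ × Y₃`, `Y₃` of type `(2,1)` with `End⁰(Y₃) = ℚ(√-d)`, `E` a CM
# elliptic curve): the census node X1 (codimension three) DISCHARGED IN THE KERNEL on the whole isogeny class, NO binder —
# cell `pub-hodgeav-hg6`, req-37 (A) Q2b; census programme γ2, brick γ2-D(ii), eng-2 g6 (lead g3 2026-08-29T01:57:40Z)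

HONEST FRAMING. HC, `HC_AV` (stmt-1333), `HC_CM` (stmt-3052) and the rung H2 are NOT proved and do not occur here. The
census nodes `TableX.SixfoldCodimTwoCensus` (X2) / `TableX.SixfoldCodimThreeCensus` (X1) of `SixfoldTableXCover` are OURS
(`@[conjecture]`), never asserted — they quantify over ALL off-residue sixfolds; here X1 is DISCHARGED on one isogeny class
per hypothesis set. KERNEL ONLY: theorems over existing declarations; no definition, no `sorry`, no named fact, no displayed
hypothesis; typed ≠ proved.

WHY THIS MODULE (census-node self-audit, axis A7 «a row VERIFIED in the kernel, not by dossier», continued from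
`SixfoldTableXCensusRow21CodimTwo`, which did X2). The Literature brick
`UnitaryTwoOneTimesCMCurveCubeCodimThreeProducts` proves, UNCONDITIONALLY, Moonen–Zarhin's Thm. 0.2 (1) mechanism in
codimension three for the sixfold `T × E³`: `B³(T × E³) ⊆ D³ + B² ⌣ B¹` (every rational `(3,3)`-class is a `ℂ`-combination of
products of divisor classes and of products of a rational `(2,2)`-class with a rational `(1,1)`-class; atlas «exc 18 = the
pull-backs of the Weil classes of `T × E` times divisors», TABLE-X-g6-v0 §1 row 21 — without naming the Weil classes).
THIS FILE reads that in census currency: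
* §1 `codimThreeCensusAt_unitaryTwoOne_prod_cmCurveCube` — X1 AT `Y × ((E × E) × E)` itself (first two of the four summands).
* §2 **`census_row21_codimThree`** — TABLE X ROW 21, ALL MEMBERS, CODIMENSION THREE: for `Y` a complex abelian threefold with
  `dim_ℚ End⁰(Y) = 2`, `φ ≫ φ = -d` of multiplicity `1` at `± i√d`, `E` an elliptic curve with `χ ≫ χ = -d'` (ANY `d, d' > 0`) and
  every `A ∼ Y × ((E × E) × E)`: `dim A = 6 ∧ ¬ 𝒞 A` (domain, from the codim-2 file) AND X1-at-`A` (L7b transport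
  `codimThreeCensusAt_iff_of_isIsogenous`); `census_row21_codimThree'` for the order `A ∼ E³ × Y`;
  `census_row21` = X2 ∧ X1 at every member.

READING (honest scope). With `SixfoldTableXCensusRow21CodimTwo`, BOTH census nodes at row 21 are kernel theorems for EVERY
member, no binder; HC for row 21 itself ⟸ Markman₄ (the cover's binder) or Abdulali/FF26 as recorded — NOT proved here. No
inhabitant is exhibited and none is invented. All declarations live in `TableX.ProductRows` (lead g2 DEDUP RULE). Nothing
here is a corollary of `HC_CM`; typed ≠ proved.
-/

set_option linter.dupNamespace false

noncomputable section

open CategoryTheory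
open Literature.AlgebraicGeometry Literature.AlgebraicGeometry.Motives
open Literature.AlgebraicGeometry.Motives.AbelianVariety (IsIsogenous IsSimple)
open Literature.AlgebraicGeometry.HodgeTheory
open Literature.AlgebraicGeometry.Milne1999
open Literature.AlgebraicTopology.SingularHomology
open Literature.Barriers.HodgeConjecture
open Summit.HodgeConjecture.HodgeConjecture.Ring2.ClassTargets
open Summit.HodgeConjecture.HodgeConjecture.Ring2.Motiv (ProdCMCell)
open Summit.HodgeConjecture.HodgeConjecture.Ring2.Atlas (IsQuarticFieldTypeIVFourfold)
open Summit.HodgeConjecture.HodgeConjecture.TableX.TypeIVRows (isSimple_and_not_isOfCMType_of_ribetTypeOne)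

namespace Summit.HodgeConjecture.HodgeConjecture.TableX.ProductRows

section Row21CodimThree

variable {Y E : AbelianVariety ℂ}

/-! ## §1 X1 at `Y × E³` itself -/

/-- **X1 AT `Y × E³`** (`E³ = (E × E) × E`): every rational `(3,3)`-class on `Y × ((E × E) × E)` lies in `D³` plus the span of the
products `a ⌣ b` of a rational `(2,2)`-class and a rational `(1,1)`-class (the first two of the four summands of the codimension-3
census conclusion; `Y` of type `(2,1)` over `ℚ(√-d)`, `E` with complex multiplication `χ ≫ χ = -d'`, ANY `d, d' > 0`).
HC ∕ HC_AV NOT proved. [cite: MoonenZarhin1999LowDim, Thm. 0.2 (1) with cases (a), (e) and §5 (5.3), (5.11)]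
[cite: vanGeemen1994HodgeAV, 4.9] -/
theorem codimThreeCensusAt_unitaryTwoOne_prod_cmCurveCube (hY3 : Y.dim = 3) (hY2 : Module.finrank ℚ Y.endAlgebra = 2)
    (φ : Y ⟶ Y) {d : ℕ} (hd : 0 < d) (hφ : φ ≫ φ = -(d • 𝟙 Y))
    (hm1 : eigenMultiplicity Y φ (Complex.I * (Real.sqrt d : ℂ)) = 1 ∨
      eigenMultiplicity Y φ (-(Complex.I * (Real.sqrt d : ℂ))) = 1)
    (hE1 : E.dim = 1) (χ : E ⟶ E) {d' : ℕ} (hd' : 0 < d') (hχ : χ ≫ χ = -(d' • 𝟙 E)) :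
    ∀ c : complexBetti (Y.prod ((E.prod E).prod E)).X (2 * 3), IsRationalClass c →
      IsOfHodgeType (Y.prod ((E.prod E).prod E)).dim (Y.prod ((E.prod E).prod E)).X (2 * 3) 3 3 c →
      c ∈ divisorClassesSpan (Y.prod ((E.prod E).prod E)).X (Y.prod ((E.prod E).prod E)).dim 3 ⊔
        Submodule.span ℂ {w' : complexBetti (Y.prod ((E.prod E).prod E)).X (2 * 3) |
          ∃ (a : complexBetti (Y.prod ((E.prod E).prod E)).X (2 * 2)) (b : complexBetti (Y.prod ((E.prod E).prod E)).X (2 * 1)),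
            IsRationalClass a ∧ IsOfHodgeType (Y.prod ((E.prod E).prod E)).dim (Y.prod ((E.prod E).prod E)).X (2 * 2) 2 2 a ∧
            IsRationalClass b ∧ IsOfHodgeType (Y.prod ((E.prod E).prod E)).dim (Y.prod ((E.prod E).prod E)).X (2 * 1) 1 1 b ∧
            w' = cupProduct (two_mul_add_two_mul 2 1) a b} ⊔
        Submodule.span ℂ {w' : complexBetti (Y.prod ((E.prod E).prod E)).X (2 * 3) |
          ∃ (C : AbelianVariety ℂ) (g : (Y.prod ((E.prod E).prod E)).X ⟶ C.X) (w : complexBetti C.X (2 * 3)),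
            C.dim < (Y.prod ((E.prod E).prod E)).dim ∧
            IsRationalClass w ∧ IsOfHodgeType C.dim C.X (2 * 3) 3 3 w ∧ w' = complexBetti.map g (2 * 3) w} ⊔
        Submodule.span ℂ {w' : complexBetti (Y.prod ((E.prod E).prod E)).X (2 * 3) |
          ∃ (B' : AbelianVariety ℂ) (g : (Y.prod ((E.prod E).prod E)).X ⟶ B'.X) (d : ℕ) (ψ : B' ⟶ B')
            (w : complexBetti B'.X (2 * 3)),
            B'.dim = 6 ∧ 0 < d ∧ ψ ≫ ψ = -(d • 𝟙 B') ∧ IsRationalClass w ∧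
            IsOfHodgeType B'.dim B'.X (2 * 3) 3 3 w ∧ w ∈ weilClassesOf B' ψ 3 d ∧
            w' = complexBetti.map g (2 * 3) w} := by
  intro c hcQ hc
  exact Submodule.mem_sup_left (Submodule.mem_sup_left
    (mem_divisorClassesSpan_sup_span_cup_of_unitaryTwoOne_cmCurve_cube_codimThree hY3 hY2 φ hd hφ hm1 hE1 χ hd' hχ hcQ hc))

/-! ## §2 TABLE X row 21 `g6.E3xY3.(2,1)`, ALL MEMBERS, codimension three: kernel verdict with domain membership -/

/-- **TABLE X ROW 21 `g6.E3xY3.(2,1)`, ALL MEMBERS — the census node X1 (codimension three) in the KERNEL on the whole isogeny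
class, with domain membership, NO displayed hypothesis.** For `Y` a complex abelian threefold with `dim_ℚ End⁰(Y) = 2`,
`φ ≫ φ = -d` (`d > 0`) of multiplicity `1` at `i√d` or at `-i√d`, `E` an elliptic curve with complex multiplication
`χ ≫ χ = -d'` (`d' > 0`; no relation between `d` and `d'` is needed), and every `A` isogenous to `Y × ((E × E) × E)`: `dim A = 6`
and `A` is OFF the residue class `𝒞`, AND every rational `(3,3)`-class on `A` lies in `D³(A)` plus the products
`(rational (2,2)) ⌣ (rational (1,1))` (the census X1-conclusion, here already inside its first two summands), transported along
the isogeny (`codimThreeCensusAt_iff_of_isIsogenous`). HC ∕ HC_AV NOT proved; `D³ ≠ B³` not asserted.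
[cite: MoonenZarhin1999LowDim, Thm. 0.2 (1) with cases (a), (e), §2 (2.8) and §5 (5.3), (5.11)]
[cite: vanGeemen1994HodgeAV, Lemma 3.7 and 4.9] [cite: MumfordAV1970, §19 Cor. 1–2 (pp. 173–174)] -/
theorem census_row21_codimThree {A : AbelianVariety ℂ} (hY3 : Y.dim = 3) (hY2 : Module.finrank ℚ Y.endAlgebra = 2)
    (φ : Y ⟶ Y) {d : ℕ} (hd : 0 < d) (hφ : φ ≫ φ = -(d • 𝟙 Y))
    (hm1 : eigenMultiplicity Y φ (Complex.I * (Real.sqrt d : ℂ)) = 1 ∨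
      eigenMultiplicity Y φ (-(Complex.I * (Real.sqrt d : ℂ))) = 1)
    (hE1 : E.dim = 1) (χ : E ⟶ E) {d' : ℕ} (hd' : 0 < d') (hχ : χ ≫ χ = -(d' • 𝟙 E))
    (hA : IsIsogenous A (Y.prod ((E.prod E).prod E))) :
    (A.dim = 6 ∧ ¬ (IsOfCMType A ∨ ProdCMCell IsQuarticFieldTypeIVFourfold (fun Z ↦ Z.dim = 2) A)) ∧
    (∀ c : complexBetti A.X (2 * 3), IsRationalClass c → IsOfHodgeType A.dim A.X (2 * 3) 3 3 c →
      c ∈ divisorClassesSpan A.X A.dim 3 ⊔ Submodule.span ℂ {w' : complexBetti A.X (2 * 3) |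
          ∃ (a : complexBetti A.X (2 * 2)) (b : complexBetti A.X (2 * 1)),
            IsRationalClass a ∧ IsOfHodgeType A.dim A.X (2 * 2) 2 2 a ∧ IsRationalClass b ∧
            IsOfHodgeType A.dim A.X (2 * 1) 1 1 b ∧ w' = cupProduct (two_mul_add_two_mul 2 1) a b} ⊔
        Submodule.span ℂ {w' : complexBetti A.X (2 * 3) |
          ∃ (C : AbelianVariety ℂ) (g : A.X ⟶ C.X) (w : complexBetti C.X (2 * 3)), C.dim < A.dim ∧
            IsRationalClass w ∧ IsOfHodgeType C.dim C.X (2 * 3) 3 3 w ∧ w' = complexBetti.map g (2 * 3) w} ⊔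
        Submodule.span ℂ {w' : complexBetti A.X (2 * 3) |
          ∃ (B' : AbelianVariety ℂ) (g : A.X ⟶ B'.X) (d : ℕ) (ψ : B' ⟶ B') (w : complexBetti B'.X (2 * 3)),
            B'.dim = 6 ∧ 0 < d ∧ ψ ≫ ψ = -(d • 𝟙 B') ∧ IsRationalClass w ∧
            IsOfHodgeType B'.dim B'.X (2 * 3) 3 3 w ∧ w ∈ weilClassesOf B' ψ 3 d ∧
            w' = complexBetti.map g (2 * 3) w}) := by
  refine ⟨(census_row21_codimTwo hY3 hY2 φ hd hφ hm1 hE1 χ hd' hχ hA).1, ?_⟩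
  exact (codimThreeCensusAt_iff_of_isIsogenous hA).mpr
    (codimThreeCensusAt_unitaryTwoOne_prod_cmCurveCube hY3 hY2 φ hd hφ hm1 hE1 χ hd' hχ)

/-- **Row 21 in the order `A ∼ E³ × Y`** (`E.powSucc 2 = (E × E) × E`; commutativity of `×` up to isogeny,
`isIsogenous_prod_comm`). HC ∕ HC_AV NOT proved. [cite: MoonenZarhin1999LowDim, Thm. 0.2 (1) and (2.8)]
[cite: Milne1986AbelianVarieties, §12 Prop. 12.1 and p. 122] -/
theorem census_row21_codimThree' {A : AbelianVariety ℂ} (hY3 : Y.dim = 3) (hY2 : Module.finrank ℚ Y.endAlgebra = 2)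
    (φ : Y ⟶ Y) {d : ℕ} (hd : 0 < d) (hφ : φ ≫ φ = -(d • 𝟙 Y))
    (hm1 : eigenMultiplicity Y φ (Complex.I * (Real.sqrt d : ℂ)) = 1 ∨
      eigenMultiplicity Y φ (-(Complex.I * (Real.sqrt d : ℂ))) = 1)
    (hE1 : E.dim = 1) (χ : E ⟶ E) {d' : ℕ} (hd' : 0 < d') (hχ : χ ≫ χ = -(d' • 𝟙 E))
    (hA : IsIsogenous A ((E.powSucc 2).prod Y)) :
    (A.dim = 6 ∧ ¬ (IsOfCMType A ∨ ProdCMCell IsQuarticFieldTypeIVFourfold (fun Z ↦ Z.dim = 2) A)) ∧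
    (∀ c : complexBetti A.X (2 * 3), IsRationalClass c → IsOfHodgeType A.dim A.X (2 * 3) 3 3 c →
      c ∈ divisorClassesSpan A.X A.dim 3 ⊔ Submodule.span ℂ {w' : complexBetti A.X (2 * 3) |
          ∃ (a : complexBetti A.X (2 * 2)) (b : complexBetti A.X (2 * 1)),
            IsRationalClass a ∧ IsOfHodgeType A.dim A.X (2 * 2) 2 2 a ∧ IsRationalClass b ∧
            IsOfHodgeType A.dim A.X (2 * 1) 1 1 b ∧ w' = cupProduct (two_mul_add_two_mul 2 1) a b} ⊔
        Submodule.span ℂ {w' : complexBetti A.X (2 * 3) |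
          ∃ (C : AbelianVariety ℂ) (g : A.X ⟶ C.X) (w : complexBetti C.X (2 * 3)), C.dim < A.dim ∧
            IsRationalClass w ∧ IsOfHodgeType C.dim C.X (2 * 3) 3 3 w ∧ w' = complexBetti.map g (2 * 3) w} ⊔
        Submodule.span ℂ {w' : complexBetti A.X (2 * 3) |
          ∃ (B' : AbelianVariety ℂ) (g : A.X ⟶ B'.X) (d : ℕ) (ψ : B' ⟶ B') (w : complexBetti B'.X (2 * 3)),
            B'.dim = 6 ∧ 0 < d ∧ ψ ≫ ψ = -(d • 𝟙 B') ∧ IsRationalClass w ∧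
            IsOfHodgeType B'.dim B'.X (2 * 3) 3 3 w ∧ w ∈ weilClassesOf B' ψ 3 d ∧
            w' = complexBetti.map g (2 * 3) w}) :=
  census_row21_codimThree hY3 hY2 φ hd hφ hm1 hE1 χ hd' hχ (hA.trans (isIsogenous_prod_comm (E.powSucc 2) Y))

end Row21CodimThree

end Summit.HodgeConjecture.HodgeConjecture.TableX.ProductRows

end
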